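import Summits.AnomalousDissipation.AnomalousDissipation.Theorems.SolenoidalFractalHomogenisationLagrangianStepCellGridProjection
import Summits.AnomalousDissipation.AnomalousDissipation.Theorems.SolenoidalFractalHomogenisationLagrangianStepOneLevelSplitDefsW7
import Literature.Analysis.FunctionSpaces.TorusVectorParseval
import HarnessLib

/-!
# K1L_D (stmt-AnomalousDissipation-27980), registry v6 — W7 piece 1 `stub_classReduction` (M): PER-CLASS (conjugate-pair) REDUCTION of the flat
# high-label decay clause, `ClassDecayW … admAll → HighLabelDecayW …`, PROVED under the ellipticity binder `0 < lo` (helper; `--supports stmt-AnomalousDissipation-27980`)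

`classReduction_of_pos (hlo : 0 < lo) : ClassDecayW W M hM lo hi Λ β ν₀ Kb CK cK admAll → HighLabelDecayW W M hM lo hi Λ β ν₀ Kb CK cK` — the
registered text of `stub_classReduction` (registry v6 l.483) VERBATIM except for the added binder `(hlo : 0 < lo)`.  WHY THE BINDER: the classes
near the lattice (`dist(ℓ_c + nℤ³, 0) < L`) carry no datum, and the projected solution there must be shown to vanish from a zero datum — that is
UNIQUENESS in the weak class (`PassiveVectorTensorUniqueness.ae_eq_zero_of_memLp_top`), which needs a Legendre–Hadamard lower constant `> 0`; for
`lo ≤ 0` the tree has no such statement (and the all-classes-near corner `F = 0`, `u` a non-unique solution, would falsify the implication if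
uniqueness failed).  The in-skeleton consumer `stub_highLabelDecay_IS` has `0 < lo` in scope, so the registry fix is one binder (reported as
`stub-misstated`).
PROOF = planner ad-ideate-p4 g13's isotypic pair-projection argument (tenure D25-5, registry v6 docstring): for `n ≥ 1` the cell problem (tensor
`(1/n²)•𝔸`, carrier `cellField W M hM ν _ n`) is invariant under the translation group `(n⁻¹ℤ/ℤ)³` (`cell_add_grid`), so for every residue class
`c ∈ (ℤ/n)³` the REAL CHARACTER AVERAGE `R_c v := Σ_{j ∈ (ℤ/n)³} n⁻³ cos(2π c·j/n) · v(· + j/n)` maps weak solutions to weak solutions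
(`IsWeakTensorPassiveVectorOn.sum_smul_translate'`), acts on Fourier coefficients as the multiplier `m_c(k) = ([k ≡ −c] + [k ≡ c])/2`
(`multiplier_eq`, from ad-lit's `sum_cos_mul_mFourier_grid` — character orthogonality), hence lands in the conjugate pair of classes `±c`
(`modeCoeff_pairProj_eq_zero_off`) and preserves the datum class (`isDatum_pairProj`: `H¹` by coefficient domination, zero mean, weak divergence-freeness).
Far classes are handled by `ClassDecayW`; near classes carry no datum (`pairProj_ae_eq_zero_of_near`) so their projected solutions vanish (uniqueness);
the pieces re-assemble by Parseval with the weights `β_c = 1` (self-conjugate class, `2c ≡ 0`) / `β_c = 2` (otherwise):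
`Σ_c β_c |m_c(k)|² = 1` (`sum_classWeight_mul_normSq_multiplier`), so `∫‖v‖² = Σ_c β_c ∫‖R_c v‖²` for every `L²` field
(`integral_norm_sq_eq_sum_classes`) — no per-class existence theory is needed.
No named facts, no new definitions, no sorry.  NOT a proof of the crux / of AD; rung F-D1.A0.  Prover seat `ad-k1l-cellLawV-w1` g3, 2026-08-28.
-/

set_option linter.dupNamespace false

noncomputable section

namespace Summit.AnomalousDissipation.AnomalousDissipation.Theorems.SolenoidalFractalHomogenisation.LagrangianStep

open Literature.Analysis Literature.Analysis.FluidPDE Literature.Analysis.FunctionSpaces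
open MeasureTheory Set Filter Function UnitAddTorus
open scoped ENNReal NNReal InnerProductSpace
open Summit.AnomalousDissipation.AnomalousDissipation.Theorems.SolenoidalFractalHomogenisation.RealisedQuasiStaticCellLaw
  (memLp_two_of_memSobolev_one_complexify memLp_top_stLift_cell)

namespace ClassReduction

/-! ## §1 The pair-character multiplier of a residue class -/

variable {n : ℕ}

/-- **The multiplier of the pair projection** (character orthogonality on `(ℤ/n)³`):
`Σ_j n⁻³cos(2π ℓ·j/n) e_k(j/n) = ([n ∣ k + ℓ] + [n ∣ k − ℓ])/2`. [cite: MontgomeryVaughan2007, §4.1 (4.1)] -/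
theorem multiplier_eq (hn : 0 < n) (ℓ k : Fin 3 → ℤ) :
    (∑ j : Fin 3 → Fin n, (((1 / (n:ℝ) ^ 3 * Real.cos (2 * Real.pi * (∑ i, (ℓ i : ℝ) * ((j i : ℕ) : ℝ)) / n)) : ℝ) : ℂ) * mFourier k (fun i => ((((j i : ℕ) : ℝ) / n : ℝ) : UnitAddCircle))) =
      ((if ∀ i, (n:ℤ) ∣ k i + ℓ i then (1:ℂ) else 0) + (if ∀ i, (n:ℤ) ∣ k i - ℓ i then (1:ℂ) else 0)) / 2 := by
  have hn0 : (n:ℂ) ≠ 0 := by exact_mod_cast hn.ne'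
  have hn3 : (n:ℂ) ^ 3 ≠ 0 := pow_ne_zero _ hn0
  have e : ∀ j : Fin 3 → Fin n, (((1 / (n:ℝ) ^ 3 * Real.cos (2 * Real.pi * (∑ i, (ℓ i : ℝ) * ((j i : ℕ) : ℝ)) / n)) : ℝ) : ℂ) * mFourier k (fun i => ((((j i : ℕ) : ℝ) / n : ℝ) : UnitAddCircle)) =
      (1 / (n:ℂ) ^ 3) * (((Real.cos (2 * Real.pi * (∑ i, (ℓ i : ℝ) * ((j i : ℕ) : ℝ)) / n) : ℝ) : ℂ) * mFourier k (fun i => ((((j i : ℕ) : ℝ) / n : ℝ) : UnitAddCircle))) := by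
    intro j
    simp only [Complex.ofReal_mul]
    push_cast
    ring
  rw [Finset.sum_congr rfl fun j _ => e j, ← Finset.mul_sum]
  have h := FunctionSpaces.Torus.sum_cos_mul_mFourier_grid hn ℓ k
  simp only [Fintype.card_fin] at h
  rw [show (fun j : Fin 3 → Fin n => ((Real.cos (2 * Real.pi * (∑ i, (ℓ i : ℝ) * ((j i : ℕ) : ℝ)) / n) : ℝ) : ℂ) *
      mFourier k (fun i => ((((j i : ℕ) : ℝ) / n : ℝ) : UnitAddCircle))) = fun j => ((Real.cos (2 * Real.pi * (∑ i, (ℓ i : ℝ) * ((j i : ℕ) : ℝ)) / n) : ℝ) : ℂ) *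
      mFourier k (fun i => ((((j i : ℕ) : ℝ) / n : ℝ) : UnitAddCircle)) from rfl, h]
  split_ifs <;> field_simp <;> ring

/-- The multiplier has modulus at most one. [folklore] -/
theorem norm_multiplier_le_one (hn : 0 < n) (ℓ k : Fin 3 → ℤ) :
    ‖∑ j : Fin 3 → Fin n, (((1 / (n:ℝ) ^ 3 * Real.cos (2 * Real.pi * (∑ i, (ℓ i : ℝ) * ((j i : ℕ) : ℝ)) / n)) : ℝ) : ℂ) * mFourier k (fun i => ((((j i : ℕ) : ℝ) / n : ℝ) : UnitAddCircle))‖ ≤ 1 := by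
  rw [multiplier_eq hn]
  split_ifs <;> norm_num

/-- Off the conjugate pair of classes the multiplier vanishes. [folklore] -/
theorem multiplier_eq_zero_off (hn : 0 < n) (ℓ k : Fin 3 → ℤ) (h1 : ¬ ∀ i, (n:ℤ) ∣ k i - ℓ i) (h2 : ¬ ∀ i, (n:ℤ) ∣ k i + ℓ i) :
    (∑ j : Fin 3 → Fin n, (((1 / (n:ℝ) ^ 3 * Real.cos (2 * Real.pi * (∑ i, (ℓ i : ℝ) * ((j i : ℕ) : ℝ)) / n)) : ℝ) : ℂ) * mFourier k (fun i => ((((j i : ℕ) : ℝ) / n : ℝ) : UnitAddCircle))) = 0 := by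
  rw [multiplier_eq hn, if_neg h2, if_neg h1]; simp

/-- The multiplier is `1` when both divisibilities hold, `1/2` when exactly one holds: its squared modulus. [folklore] -/
theorem normSq_multiplier_eq (hn : 0 < n) (ℓ k : Fin 3 → ℤ) :
    ‖∑ j : Fin 3 → Fin n, (((1 / (n:ℝ) ^ 3 * Real.cos (2 * Real.pi * (∑ i, (ℓ i : ℝ) * ((j i : ℕ) : ℝ)) / n)) : ℝ) : ℂ) * mFourier k (fun i => ((((j i : ℕ) : ℝ) / n : ℝ) : UnitAddCircle))‖ ^ 2 =
      ((if ∀ i, (n:ℤ) ∣ k i + ℓ i then (1:ℝ) else 0) + (if ∀ i, (n:ℤ) ∣ k i - ℓ i then (1:ℝ) else 0)) ^ 2 / 4 := by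
  rw [multiplier_eq hn]
  split_ifs <;> norm_num

/-! ## §2 The class of a frequency; the weighted multipliers sum to one -/

/-- Every frequency has exactly one residue class: there is `c₀ ∈ (ℤ/n)³` with `(n ∣ k − c coordinatewise) ↔ c = c₀`. [folklore] -/
theorem exists_class (hn : 0 < n) (k : Fin 3 → ℤ) :
    ∃ c₀ : Fin 3 → Fin n, ∀ c : Fin 3 → Fin n, (∀ i, (n:ℤ) ∣ k i - ((c i : ℕ) : ℤ)) ↔ c = c₀ := by
  have hn' : (0:ℤ) < n := by exact_mod_cast hn
  have hbound : ∀ i, (k i % (n:ℤ)).toNat < n := fun i => by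
    have h0 : 0 ≤ k i % (n:ℤ) := Int.emod_nonneg _ hn'.ne'
    have h1 : k i % (n:ℤ) < n := Int.emod_lt_of_pos _ hn'
    omega
  refine ⟨fun i => ⟨(k i % (n:ℤ)).toNat, hbound i⟩, fun c => ⟨fun h => ?_, ?_⟩⟩
  · funext i
    apply Fin.ext
    have hd := h i
    have hci : ((c i : ℕ) : ℤ) < n := by exact_mod_cast (c i).isLt
    have hc0 : (0:ℤ) ≤ ((c i : ℕ) : ℤ) := by positivity
    have hmod : k i % (n:ℤ) = ((c i : ℕ) : ℤ) := by
      have h1 : (k i - ((c i : ℕ) : ℤ)) % (n:ℤ) = 0 := Int.emod_eq_zero_of_dvd hd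
      have h2 : k i % (n:ℤ) = (((c i : ℕ) : ℤ) + (k i - ((c i : ℕ) : ℤ))) % (n:ℤ) := by ring_nf
      rw [h2, Int.add_emod, h1, add_zero, Int.emod_emod_of_dvd _ dvd_rfl, Int.emod_eq_of_lt hc0 hci]
    show (c i : ℕ) = (k i % (n:ℤ)).toNat
    rw [hmod]; simp
  · rintro rfl i
    show (n:ℤ) ∣ k i - (((k i % (n:ℤ)).toNat : ℕ) : ℤ)
    rw [Int.toNat_of_nonneg (Int.emod_nonneg _ hn'.ne')]
    exact ⟨k i / (n:ℤ), by rw [Int.emod_def]; ring⟩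

/-- The conjugate class: `(n ∣ k + c) ↔ c = c₁` for the class `c₁` of `−k`. [folklore] -/
theorem exists_conj_class (hn : 0 < n) (k : Fin 3 → ℤ) :
    ∃ c₁ : Fin 3 → Fin n, ∀ c : Fin 3 → Fin n, (∀ i, (n:ℤ) ∣ k i + ((c i : ℕ) : ℤ)) ↔ c = c₁ := by
  obtain ⟨c₁, h⟩ := exists_class hn (-k)
  refine ⟨c₁, fun c => ?_⟩
  rw [← h c]
  refine forall_congr' fun i => ?_
  rw [Pi.neg_apply, show -k i - ((c i : ℕ) : ℤ) = -(k i + ((c i : ℕ) : ℤ)) by ring, dvd_neg]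

/-- **The weighted squared multipliers sum to one**: `Σ_c β_c |m_c(k)|² = 1` for every frequency `k`. [folklore] -/
theorem sum_classWeight_mul_normSq_multiplier (hn : 0 < n) (k : Fin 3 → ℤ) :
    ∑ c : Fin 3 → Fin n, (if ∀ i, (n:ℤ) ∣ 2 * ((c i : ℕ) : ℤ) then (1:ℝ) else 2) * ‖∑ j : Fin 3 → Fin n, (((1 / (n:ℝ) ^ 3 * Real.cos (2 * Real.pi * (∑ i, ((fun i => ((c i : ℕ) : ℤ)) i : ℝ) * ((j i : ℕ) : ℝ)) / n)) : ℝ) : ℂ) * mFourier k (fun i => ((((j i : ℕ) : ℝ) / n : ℝ) : UnitAddCircle))‖ ^ 2 = 1 := by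
  simp_rw [normSq_multiplier_eq hn]
  obtain ⟨c₀, hB⟩ := exists_class hn k
  obtain ⟨c₁, hA⟩ := exists_conj_class hn k
  -- self-conjugacy of `c₀` is `c₀ = c₁`
  have hsc : (∀ i, (n:ℤ) ∣ 2 * ((c₀ i : ℕ) : ℤ)) ↔ c₀ = c₁ := by
    rw [← hA c₀]
    have h0 : ∀ i, (n:ℤ) ∣ k i - ((c₀ i : ℕ) : ℤ) := (hB c₀).2 rfl
    refine forall_congr' fun i => ?_
    have e : k i + ((c₀ i : ℕ) : ℤ) = 2 * ((c₀ i : ℕ) : ℤ) + (k i - ((c₀ i : ℕ) : ℤ)) := by ring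
    rw [e]
    exact (dvd_add_left (h0 i)).symm
  by_cases h01 : c₀ = c₁
  · -- one class carries everything
    rw [Finset.sum_eq_single c₀]
    · have h1 : ∀ i, (n:ℤ) ∣ k i + ((c₀ i : ℕ) : ℤ) := (hA c₀).2 h01
      have h2 : ∀ i, (n:ℤ) ∣ k i - ((c₀ i : ℕ) : ℤ) := (hB c₀).2 rfl
      rw [if_pos h1, if_pos h2, show (if ∀ i, (n:ℤ) ∣ 2 * ((c₀ i : ℕ) : ℤ) then (1:ℝ) else 2) = 1 from if_pos (hsc.2 h01)]
      norm_num
    · intro c _ hc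
      have h1 : ¬ ∀ i, (n:ℤ) ∣ k i + ((c i : ℕ) : ℤ) := fun h => hc ((hA c).1 h ▸ h01.symm ▸ rfl)
      have h2 : ¬ ∀ i, (n:ℤ) ∣ k i - ((c i : ℕ) : ℤ) := fun h => hc ((hB c).1 h)
      rw [if_neg h1, if_neg h2]; simp
    · intro h; exact absurd (Finset.mem_univ _) h
  · -- two classes, each with multiplier `1/2` and weight `2`
    have hne : c₀ ≠ c₁ := h01
    rw [← Finset.sum_subset (Finset.subset_univ ({c₀, c₁} : Finset (Fin 3 → Fin n)))]
    · rw [Finset.sum_pair hne]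
      have hB0 : ∀ i, (n:ℤ) ∣ k i - ((c₀ i : ℕ) : ℤ) := (hB c₀).2 rfl
      have hA0 : ¬ ∀ i, (n:ℤ) ∣ k i + ((c₀ i : ℕ) : ℤ) := fun h => hne ((hA c₀).1 h)
      have hA1 : ∀ i, (n:ℤ) ∣ k i + ((c₁ i : ℕ) : ℤ) := (hA c₁).2 rfl
      have hB1 : ¬ ∀ i, (n:ℤ) ∣ k i - ((c₁ i : ℕ) : ℤ) := fun h => hne ((hB c₁).1 h).symm
      have hw0 : (if ∀ i, (n:ℤ) ∣ 2 * ((c₀ i : ℕ) : ℤ) then (1:ℝ) else 2) = 2 := if_neg fun h => hne (hsc.1 h)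
      have hw1 : (if ∀ i, (n:ℤ) ∣ 2 * ((c₁ i : ℕ) : ℤ) then (1:ℝ) else 2) = 2 := by
        refine if_neg fun h => hne ?_
        -- `2 (fun i => ((c₁ i : ℕ) : ℤ)) ≡ 0` and `k ≡ -(fun i => ((c₁ i : ℕ) : ℤ))` give `k ≡ (fun i => ((c₁ i : ℕ) : ℤ))`, so `c₁ = c₀`
        have : ∀ i, (n:ℤ) ∣ k i - ((c₁ i : ℕ) : ℤ) := fun i => by
          have e : k i - ((c₁ i : ℕ) : ℤ) = (k i + ((c₁ i : ℕ) : ℤ)) - 2 * ((c₁ i : ℕ) : ℤ) := by ring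
          rw [e]; exact dvd_sub (hA1 i) (h i)
        exact (((hB c₁).1 this)).symm
      rw [if_neg hA0, if_pos hB0, if_pos hA1, if_neg hB1, hw0, hw1]
      norm_num
    · intro c _ hc
      rw [Finset.mem_insert, Finset.mem_singleton, not_or] at hc
      have h1 : ¬ ∀ i, (n:ℤ) ∣ k i + ((c i : ℕ) : ℤ) := fun h => hc.2 ((hA c).1 h)
      have h2 : ¬ ∀ i, (n:ℤ) ∣ k i - ((c i : ℕ) : ℤ) := fun h => hc.1 ((hB c).1 h)
      rw [if_neg h1, if_neg h2]; simp

/-! ## §3 The pair projection `R_ℓ v = Σ_j n⁻³cos(2πℓ·j/n) v(· + j/n)` of a field: multiplier, datum class, support, Parseval -/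

/-- Fourier multiplier of the pair projection: `𝓕(R_ℓ v)(k) = m_ℓ(k) • 𝓕v(k)`. [cite: Grafakos2014, Prop. 3.2.2 (6)] -/
theorem mFourierCoeff_pairProj (ℓ : Fin 3 → ℤ) {v : VF} (hv : Integrable v volume) (k : Fin 3 → ℤ) :
    mFourierCoeff (FunctionSpaces.EuclideanSpace.complexify ∘ fun x => ∑ j : Fin 3 → Fin n, (1 / (n:ℝ) ^ 3 * Real.cos (2 * Real.pi * (∑ i, (ℓ i : ℝ) * ((j i : ℕ) : ℝ)) / n)) • v (x + (fun i => ((((j i : ℕ) : ℝ) / n : ℝ) : UnitAddCircle)))) k =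
      (∑ j : Fin 3 → Fin n, (((1 / (n:ℝ) ^ 3 * Real.cos (2 * Real.pi * (∑ i, (ℓ i : ℝ) * ((j i : ℕ) : ℝ)) / n)) : ℝ) : ℂ) * mFourier k (fun i => ((((j i : ℕ) : ℝ) / n : ℝ) : UnitAddCircle))) •
        mFourierCoeff (FunctionSpaces.EuclideanSpace.complexify ∘ v) k :=
  Torus.mFourierCoeff_complexify_sum_smul_translate' (fun (j : Fin 3 → Fin n) (i : Fin 3) => ((((j i : ℕ) : ℝ) / n : ℝ) : UnitAddCircle)) ((fun j : Fin 3 → Fin n => 1 / (n:ℝ) ^ 3 * Real.cos (2 * Real.pi * (∑ i, (ℓ i : ℝ) * ((j i : ℕ) : ℝ)) / n))) hv k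

/-- The pair projection of an integrable field is integrable. [folklore] -/
theorem integrable_pairProj (ℓ : Fin 3 → ℤ) {v : VF} (hv : Integrable v volume) :
    Integrable (fun x => ∑ j : Fin 3 → Fin n, (1 / (n:ℝ) ^ 3 * Real.cos (2 * Real.pi * (∑ i, (ℓ i : ℝ) * ((j i : ℕ) : ℝ)) / n)) • v (x + (fun i => ((((j i : ℕ) : ℝ) / n : ℝ) : UnitAddCircle)))) volume :=
  integrable_finsetSum _ fun j _ => by simpa only [Pi.smul_def] using (hv.comp_add_right (fun i => ((((j i : ℕ) : ℝ) / n : ℝ) : UnitAddCircle))).smul ((1 / (n:ℝ) ^ 3 * Real.cos (2 * Real.pi * (∑ i, (ℓ i : ℝ) * ((j i : ℕ) : ℝ)) / n)))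

/-- The Fourier coefficients of the pair projection are dominated by those of the field (`|m| ≤ 1`). [folklore] -/
theorem norm_mFourierCoeff_pairProj_le (hn : 0 < n) (ℓ : Fin 3 → ℤ) {v : VF} (hv : Integrable v volume) (k : Fin 3 → ℤ) :
    ‖mFourierCoeff (FunctionSpaces.EuclideanSpace.complexify ∘ fun x => ∑ j : Fin 3 → Fin n, (1 / (n:ℝ) ^ 3 * Real.cos (2 * Real.pi * (∑ i, (ℓ i : ℝ) * ((j i : ℕ) : ℝ)) / n)) • v (x + (fun i => ((((j i : ℕ) : ℝ) / n : ℝ) : UnitAddCircle)))) k‖ ≤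
      ‖mFourierCoeff (FunctionSpaces.EuclideanSpace.complexify ∘ v) k‖ := by
  rw [mFourierCoeff_pairProj ℓ hv k, norm_smul]
  exact (mul_le_mul_of_nonneg_right (norm_multiplier_le_one hn ℓ k) (norm_nonneg _)).trans (by rw [one_mul])

/-- The pair projection preserves `H¹` (coefficientwise domination of the Sobolev sum). [folklore] -/
theorem memSobolev_pairProj (hn : 0 < n) (ℓ : Fin 3 → ℤ) {v : VF}
    (hv : FunctionSpaces.Torus.MemSobolev 1 (FunctionSpaces.EuclideanSpace.complexify ∘ v)) :
    FunctionSpaces.Torus.MemSobolev 1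
      (FunctionSpaces.EuclideanSpace.complexify ∘ fun x => ∑ j : Fin 3 → Fin n, (1 / (n:ℝ) ^ 3 * Real.cos (2 * Real.pi * (∑ i, (ℓ i : ℝ) * ((j i : ℕ) : ℝ)) / n)) • v (x + (fun i => ((((j i : ℕ) : ℝ) / n : ℝ) : UnitAddCircle)))) := by
  have hvi : Integrable v volume := (memLp_two_of_memSobolev_one_complexify hv).integrable one_le_two
  refine ⟨FunctionSpaces.EuclideanSpace.complexify.toContinuousLinearMap.integrable_comp (integrable_pairProj ℓ hvi), ?_⟩
  refine lt_of_le_of_lt ?_ hv.2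
  unfold FunctionSpaces.Torus.eSobolevNorm
  refine ENNReal.rpow_le_rpow (ENNReal.tsum_le_tsum fun k => ?_) (by norm_num)
  have hk : ‖mFourierCoeff (FunctionSpaces.EuclideanSpace.complexify ∘ fun x => ∑ j : Fin 3 → Fin n, (1 / (n:ℝ) ^ 3 * Real.cos (2 * Real.pi * (∑ i, (ℓ i : ℝ) * ((j i : ℕ) : ℝ)) / n)) • v (x + (fun i => ((((j i : ℕ) : ℝ) / n : ℝ) : UnitAddCircle)))) k‖ₑ ≤
      ‖mFourierCoeff (FunctionSpaces.EuclideanSpace.complexify ∘ v) k‖ₑ := by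
    rw [← ofReal_norm, ← ofReal_norm]
    exact ENNReal.ofReal_le_ofReal (norm_mFourierCoeff_pairProj_le hn ℓ hvi k)
  gcongr

/-- The pair projection preserves zero mean. [folklore] -/
theorem hasZeroMean_pairProj (ℓ : Fin 3 → ℤ) {v : VF} (hv : Integrable v volume) (h0 : FunctionSpaces.Torus.HasZeroMean v) :
    FunctionSpaces.Torus.HasZeroMean (fun x => ∑ j : Fin 3 → Fin n, (1 / (n:ℝ) ^ 3 * Real.cos (2 * Real.pi * (∑ i, (ℓ i : ℝ) * ((j i : ℕ) : ℝ)) / n)) • v (x + (fun i => ((((j i : ℕ) : ℝ) / n : ℝ) : UnitAddCircle)))) := by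
  unfold FunctionSpaces.Torus.HasZeroMean at h0 ⊢
  rw [integral_finsetSum _ fun j _ => by simpa only [Pi.smul_def] using (hv.comp_add_right (fun i => ((((j i : ℕ) : ℝ) / n : ℝ) : UnitAddCircle))).smul ((1 / (n:ℝ) ^ 3 * Real.cos (2 * Real.pi * (∑ i, (ℓ i : ℝ) * ((j i : ℕ) : ℝ)) / n)))]
  refine Finset.sum_eq_zero fun j _ => ?_
  rw [integral_smul, integral_add_right_eq_self v (fun i => ((((j i : ℕ) : ℝ) / n : ℝ) : UnitAddCircle)), h0, smul_zero]

/-- The pair projection of a datum is a datum. [folklore] -/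
theorem isDatum_pairProj (hn : 0 < n) (ℓ : Fin 3 → ℤ) {F : VF} (hF : IsDatum F) :
    IsDatum (fun x => ∑ j : Fin 3 → Fin n, (1 / (n:ℝ) ^ 3 * Real.cos (2 * Real.pi * (∑ i, (ℓ i : ℝ) * ((j i : ℕ) : ℝ)) / n)) • F (x + (fun i => ((((j i : ℕ) : ℝ) / n : ℝ) : UnitAddCircle)))) := by
  have hFi : Integrable F volume := (memLp_two_of_memSobolev_one_complexify hF.1).integrable one_le_two
  exact ⟨memSobolev_pairProj hn ℓ hF.1, hasZeroMean_pairProj ℓ hFi hF.2.1, isWeaklyDivFree_sum_smul_translate _ _ hF.2.2 hFi⟩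

/-- Divisibility by `n` coordinatewise means lying in the class: `k = ℓ + n•z`. [folklore] -/
theorem exists_eq_add_zsmul_of_dvd {ℓ k : Fin 3 → ℤ} (h : ∀ i, (n:ℤ) ∣ k i - ℓ i) : ∃ z : Fin 3 → ℤ, k = ℓ + (n:ℤ) • z := by
  refine ⟨fun i => (k i - ℓ i) / (n:ℤ), funext fun i => ?_⟩
  simp only [Pi.add_apply, Pi.smul_apply, smul_eq_mul]
  rw [Int.mul_ediv_cancel' (h i)]; ring

/-- SUPPORT: the pair projection has no modes off the conjugate pair of classes `(ℓ + nℤ³) ∪ (−ℓ + nℤ³)`. [folklore] -/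
theorem modeCoeff_pairProj_eq_zero_off (hn : 0 < n) (ℓ : Fin 3 → ℤ) {F : VF} (hFi : Integrable F volume) (k' : Fin 3 → ℤ)
    (h1 : ¬ ∃ z : Fin 3 → ℤ, k' = ℓ + (n:ℤ) • z) (h2 : ¬ ∃ z : Fin 3 → ℤ, k' = -ℓ + (n:ℤ) • z) (i : Fin 3) :
    modeCoeff k' (fun x => ∑ j : Fin 3 → Fin n, (1 / (n:ℝ) ^ 3 * Real.cos (2 * Real.pi * (∑ i, (ℓ i : ℝ) * ((j i : ℕ) : ℝ)) / n)) • F (x + (fun i => ((((j i : ℕ) : ℝ) / n : ℝ) : UnitAddCircle)))) i = 0 := by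
  rw [modeCoeff_eq (integrable_pairProj ℓ hFi), mFourierCoeff_pairProj ℓ hFi]
  have hm := multiplier_eq_zero_off hn ℓ k' (fun h => h1 (exists_eq_add_zsmul_of_dvd h))
    (fun h => h2 (exists_eq_add_zsmul_of_dvd (ℓ := -ℓ) fun i => by simpa [sub_neg_eq_add] using h i))
  rw [hm, zero_smul]; rfl

/-- NEAR CLASSES CARRY NO DATUM: if the class of `ℓ` has a representative of norm `< L` and `F` has no modes with such representatives, then
the pair projection of `F` onto `±ℓ` vanishes a.e. [folklore] -/
theorem pairProj_ae_eq_zero_of_near (hn : 0 < n) (ℓ : Fin 3 → ℤ) {F : VF} (hFi : Integrable F volume) {L : ℝ}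
    (hsupp : ∀ k' : Fin 3 → ℤ, (∃ ℓ' z : Fin 3 → ℤ, ‖Torus.latticeVec ℓ'‖ < L ∧ k' = ℓ' + (n:ℤ) • z) → ∀ i, modeCoeff k' F i = 0)
    (hnear : ∃ z : Fin 3 → ℤ, ‖Torus.latticeVec (ℓ + (n:ℤ) • z)‖ < L) :
    (fun x => ∑ j : Fin 3 → Fin n, (1 / (n:ℝ) ^ 3 * Real.cos (2 * Real.pi * (∑ i, (ℓ i : ℝ) * ((j i : ℕ) : ℝ)) / n)) • F (x + (fun i => ((((j i : ℕ) : ℝ) / n : ℝ) : UnitAddCircle)))) =ᵐ[volume] 0 := by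
  obtain ⟨z₀, hz₀⟩ := hnear
  have hRi := integrable_pairProj (n := n) ℓ hFi
  -- all Fourier coefficients of the complexified projection vanish
  have hzero : ∀ k, mFourierCoeff (FunctionSpaces.EuclideanSpace.complexify ∘
      fun x => ∑ j : Fin 3 → Fin n, (1 / (n:ℝ) ^ 3 * Real.cos (2 * Real.pi * (∑ i, (ℓ i : ℝ) * ((j i : ℕ) : ℝ)) / n)) • F (x + (fun i => ((((j i : ℕ) : ℝ) / n : ℝ) : UnitAddCircle)))) k = 0 := by
    intro k
    rw [mFourierCoeff_pairProj ℓ hFi, multiplier_eq hn]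
    -- either `k` is in one of the two classes, where `F̂(k) = 0`, or the multiplier vanishes
    have hFk : ((∀ i, (n:ℤ) ∣ k i + ℓ i) ∨ (∀ i, (n:ℤ) ∣ k i - ℓ i)) →
        mFourierCoeff (FunctionSpaces.EuclideanSpace.complexify ∘ F) k = 0 := by
      intro hk
      have hrep : ∃ ℓ' z : Fin 3 → ℤ, ‖Torus.latticeVec ℓ'‖ < L ∧ k = ℓ' + (n:ℤ) • z := by
        rcases hk with hk | hk
        · obtain ⟨z, hz⟩ := exists_eq_add_zsmul_of_dvd (ℓ := -ℓ) (k := k) fun i => by simpa [sub_neg_eq_add] using hk i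
          refine ⟨-(ℓ + (n:ℤ) • z₀), z + z₀, by rwa [Torus.latticeVec_neg, norm_neg], ?_⟩
          rw [hz]; funext i; simp only [Pi.add_apply, Pi.neg_apply, Pi.smul_apply, smul_eq_mul]; ring
        · obtain ⟨z, hz⟩ := exists_eq_add_zsmul_of_dvd hk
          refine ⟨ℓ + (n:ℤ) • z₀, z - z₀, hz₀, ?_⟩
          rw [hz]; funext i; simp only [Pi.add_apply, Pi.sub_apply, Pi.smul_apply, smul_eq_mul]; ring
      have h := hsupp k hrep
      ext i
      rw [← modeCoeff_eq hFi]
      simpa using h i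
    by_cases hA : ∀ i, (n:ℤ) ∣ k i + ℓ i
    · rw [hFk (Or.inl hA), smul_zero]
    · by_cases hB : ∀ i, (n:ℤ) ∣ k i - ℓ i
      · rw [hFk (Or.inr hB), smul_zero]
      · rw [if_neg hA, if_neg hB]; simp
  have hc := FunctionSpaces.Torus.ae_eq_zero_of_forall_mFourierCoeff_eq_zero
    (FunctionSpaces.EuclideanSpace.complexify.toContinuousLinearMap.integrable_comp hRi) hzero
  filter_upwards [hc] with x hx
  have hx' : FunctionSpaces.EuclideanSpace.complexify (∑ j : Fin 3 → Fin n, (1 / (n:ℝ) ^ 3 * Real.cos (2 * Real.pi * (∑ i, (ℓ i : ℝ) * ((j i : ℕ) : ℝ)) / n)) • F (x + (fun i => ((((j i : ℕ) : ℝ) / n : ℝ) : UnitAddCircle)))) = 0 := hx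
  have := congrArg norm hx'
  rw [LinearIsometry.norm_map, norm_zero] at this
  exact norm_eq_zero.mp this

/-- Parseval for the pair projection: `∫‖R_ℓ v‖² = Σ_k |m_ℓ(k)|² ‖v̂(k)‖²` (as a `HasSum`). [folklore] -/
theorem hasSum_pairProj (ℓ : Fin 3 → ℤ) {v : VF} (hv : MemLp v 2 volume) :
    HasSum (fun k : Fin 3 → ℤ => ‖∑ j : Fin 3 → Fin n, (((1 / (n:ℝ) ^ 3 * Real.cos (2 * Real.pi * (∑ i, (ℓ i : ℝ) * ((j i : ℕ) : ℝ)) / n)) : ℝ) : ℂ) * mFourier k (fun i => ((((j i : ℕ) : ℝ) / n : ℝ) : UnitAddCircle))‖ ^ 2 *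
        ‖mFourierCoeff (FunctionSpaces.EuclideanSpace.complexify ∘ v) k‖ ^ 2)
      (∫ x, ‖∑ j : Fin 3 → Fin n, (1 / (n:ℝ) ^ 3 * Real.cos (2 * Real.pi * (∑ i, (ℓ i : ℝ) * ((j i : ℕ) : ℝ)) / n)) • v (x + (fun i => ((((j i : ℕ) : ℝ) / n : ℝ) : UnitAddCircle)))‖ ^ 2) := by
  have h := FunctionSpaces.Torus.hasSum_sq_norm_mFourierCoeff_complexify (memLp_two_sum_smul_translate (fun (j : Fin 3 → Fin n) (i : Fin 3) => ((((j i : ℕ) : ℝ) / n : ℝ) : UnitAddCircle)) ((fun j : Fin 3 → Fin n => 1 / (n:ℝ) ^ 3 * Real.cos (2 * Real.pi * (∑ i, (ℓ i : ℝ) * ((j i : ℕ) : ℝ)) / n))) hv)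
  refine h.congr_fun fun k => ?_
  rw [mFourierCoeff_pairProj ℓ (hv.integrable one_le_two) k, norm_smul, mul_pow]

/-- **PARSEVAL RE-ASSEMBLY OVER THE CLASSES**: `∫‖v‖² = Σ_c β_c ∫‖R_c v‖²` for every `L²` field (`β_c ∈ {1, 2}`). [folklore] -/
theorem integral_norm_sq_eq_sum_classes (hn : 0 < n) {v : VF} (hv : MemLp v 2 volume) :
    ∫ x, ‖v x‖ ^ 2 = ∑ c : Fin 3 → Fin n, (if ∀ i, (n:ℤ) ∣ 2 * ((c i : ℕ) : ℤ) then (1:ℝ) else 2) *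
      ∫ x, ‖∑ j : Fin 3 → Fin n, (1 / (n:ℝ) ^ 3 * Real.cos (2 * Real.pi * (∑ i, ((fun i => ((c i : ℕ) : ℤ)) i : ℝ) * ((j i : ℕ) : ℝ)) / n)) • v (x + (fun i => ((((j i : ℕ) : ℝ) / n : ℝ) : UnitAddCircle)))‖ ^ 2 := by
  have h1 : HasSum (fun k : Fin 3 → ℤ => ∑ c : Fin 3 → Fin n, (if ∀ i, (n:ℤ) ∣ 2 * ((c i : ℕ) : ℤ) then (1:ℝ) else 2) *
      (‖∑ j : Fin 3 → Fin n, (((1 / (n:ℝ) ^ 3 * Real.cos (2 * Real.pi * (∑ i, ((fun i => ((c i : ℕ) : ℤ)) i : ℝ) * ((j i : ℕ) : ℝ)) / n)) : ℝ) : ℂ) * mFourier k (fun i => ((((j i : ℕ) : ℝ) / n : ℝ) : UnitAddCircle))‖ ^ 2 *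
        ‖mFourierCoeff (FunctionSpaces.EuclideanSpace.complexify ∘ v) k‖ ^ 2))
      (∑ c : Fin 3 → Fin n, (if ∀ i, (n:ℤ) ∣ 2 * ((c i : ℕ) : ℤ) then (1:ℝ) else 2) * ∫ x, ‖∑ j : Fin 3 → Fin n, (1 / (n:ℝ) ^ 3 * Real.cos (2 * Real.pi * (∑ i, ((fun i => ((c i : ℕ) : ℤ)) i : ℝ) * ((j i : ℕ) : ℝ)) / n)) • v (x + (fun i => ((((j i : ℕ) : ℝ) / n : ℝ) : UnitAddCircle)))‖ ^ 2) :=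
    hasSum_sum fun c _ => (hasSum_pairProj ((fun i => ((c i : ℕ) : ℤ))) hv).mul_left ((if ∀ i, (n:ℤ) ∣ 2 * ((c i : ℕ) : ℤ) then (1:ℝ) else 2))
  have h2 : HasSum (fun k : Fin 3 → ℤ => ‖mFourierCoeff (FunctionSpaces.EuclideanSpace.complexify ∘ v) k‖ ^ 2)
      (∑ c : Fin 3 → Fin n, (if ∀ i, (n:ℤ) ∣ 2 * ((c i : ℕ) : ℤ) then (1:ℝ) else 2) * ∫ x, ‖∑ j : Fin 3 → Fin n, (1 / (n:ℝ) ^ 3 * Real.cos (2 * Real.pi * (∑ i, ((fun i => ((c i : ℕ) : ℤ)) i : ℝ) * ((j i : ℕ) : ℝ)) / n)) • v (x + (fun i => ((((j i : ℕ) : ℝ) / n : ℝ) : UnitAddCircle)))‖ ^ 2) := by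
    refine h1.congr_fun fun k => ?_
    have h := sum_classWeight_mul_normSq_multiplier hn k
    calc ‖mFourierCoeff (FunctionSpaces.EuclideanSpace.complexify ∘ v) k‖ ^ 2
        = (∑ c : Fin 3 → Fin n, (if ∀ i, (n:ℤ) ∣ 2 * ((c i : ℕ) : ℤ) then (1:ℝ) else 2) * ‖∑ j : Fin 3 → Fin n, (((1 / (n:ℝ) ^ 3 * Real.cos (2 * Real.pi * (∑ i, ((fun i => ((c i : ℕ) : ℤ)) i : ℝ) * ((j i : ℕ) : ℝ)) / n)) : ℝ) : ℂ) * mFourier k (fun i => ((((j i : ℕ) : ℝ) / n : ℝ) : UnitAddCircle))‖ ^ 2) *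
            ‖mFourierCoeff (FunctionSpaces.EuclideanSpace.complexify ∘ v) k‖ ^ 2 := by rw [h, one_mul]
      _ = _ := by rw [Finset.sum_mul]; exact Finset.sum_congr rfl fun c _ => by ring
  exact (FunctionSpaces.Torus.hasSum_sq_norm_mFourierCoeff_complexify hv).unique h2

end ClassReduction

open ClassReduction in
/-- **PER-CLASS REDUCTION of the flat high-label decay clause** (registry v6 W7 piece 1 `stub_classReduction`, with the ELLIPTICITY binder `0 < lo`
that the registered text omits — needed for «zero datum ⇒ zero solution» on the near classes, `PassiveVectorTensorUniqueness`; the in-skeleton consumer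
`stub_highLabelDecay_IS` has `0 < lo` in scope): `ClassDecayW W M hM lo hi Λ β ν₀ Kb CK cK admAll → HighLabelDecayW W M hM lo hi Λ β ν₀ Kb CK cK`.
Proof (planner ad-ideate-p4 g13's isotypic pair projection): decompose any weak cell solution `u` into the real character averages `R_c u`
(`IsWeakTensorPassiveVectorOn.sum_smul_translate'` along the grid-invariant cell carrier), apply `ClassDecayW` on the far classes, kill the near classes
(no datum there, `pairProj_ae_eq_zero_of_near` + uniqueness `ae_eq_zero_of_memLp_top`), and re-assemble by Parseval with the weights `β_c ∈ {1,2}`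
(`integral_norm_sq_eq_sum_classes`). [cite: KhaKuchment2021, §1.1–§1.2 (G-periodic operators / Floquet–Bloch sectors)] -/
theorem classReduction_of_pos {k : ℕ} (W : LatticeShear.LatticeWord k) (M : ℝ) (hM : 0 < M) (lo hi Λ β ν₀ Kb CK cK : ℝ) (hlo : 0 < lo) :
    ClassDecayW W M hM lo hi Λ β ν₀ Kb CK cK admAll → HighLabelDecayW W M hM lo hi Λ β ν₀ Kb CK cK := by
  intro hC ν hν n hn 𝔸 hodd hwin L hL hKL F hF hsupp T hT u hu
  have hn0 : 0 < n := hn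
  haveI : Nonempty (Fin 3 → Fin n) := ⟨fun _ => ⟨0, hn0⟩⟩
  have hF2 : MemLp F 2 volume := memLp_two_of_memSobolev_one_complexify hF.1
  have hFi : Integrable F volume := hF2.integrable one_le_two
  -- carrier: grid invariance, boundedness; tensor ellipticity at some aspect
  have hper : ∀ (j : Fin 3 → Fin n) t x, cellField W M hM ν hν.1 n t (x + (fun i => ((((j i : ℕ) : ℝ) / n : ℝ) : UnitAddCircle))) = cellField W M hM ν hν.1 n t x :=
    fun j t x => by unfold cellField; exact cell_add_grid _ hn0 j t x
  have hb : MemLp (FunctionSpaces.Torus.stLift (cellField W M hM ν hν.1 n)) ∞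
      (volume.restrict (Ioo 0 T ×ˢ (univ : Set (EuclideanSpace ℝ (Fin 3))))) := by
    unfold cellField; exact memLp_top_stLift_cell _ n T
  have hwin' := hwin
  obtain ⟨lam, hlam, hA⟩ := hwin'
  have hlam0 : 0 < lam := lt_of_lt_of_le one_pos hlam.1
  have hn' : (0:ℝ) < n := by exact_mod_cast hn0
  have hN : Torus.NearIso ((1 / (n:ℝ) ^ 2) • 𝔸) ((1 / (n:ℝ) ^ 2) * (ν * (lo / lam))) ((1 / (n:ℝ) ^ 2) * (ν * (hi * lam))) :=
    hA.smul (by positivity)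
  have hlo' : 0 < (1 / (n:ℝ) ^ 2) * (ν * (lo / lam)) := by have := hν.1; positivity
  -- the projected solutions
  have hRu : ∀ c : Fin 3 → Fin n, Torus.IsWeakTensorPassiveVectorOn 0 T ((1 / (n:ℝ) ^ 2) • 𝔸) (cellField W M hM ν hν.1 n)
      (fun x => ∑ j : Fin 3 → Fin n, (1 / (n:ℝ) ^ 3 * Real.cos (2 * Real.pi * (∑ i, ((fun i => ((c i : ℕ) : ℤ)) i : ℝ) * ((j i : ℕ) : ℝ)) / n)) • F (x + (fun i => ((((j i : ℕ) : ℝ) / n : ℝ) : UnitAddCircle))))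
      (fun t x => ∑ j : Fin 3 → Fin n, (1 / (n:ℝ) ^ 3 * Real.cos (2 * Real.pi * (∑ i, ((fun i => ((c i : ℕ) : ℤ)) i : ℝ) * ((j i : ℕ) : ℝ)) / n)) • u t (x + (fun i => ((((j i : ℕ) : ℝ) / n : ℝ) : UnitAddCircle)))) :=
    fun c => hu.sum_smul_translate' (fun (j : Fin 3 → Fin n) (i : Fin 3) => ((((j i : ℕ) : ℝ) / n : ℝ) : UnitAddCircle)) ((fun j : Fin 3 → Fin n => 1 / (n:ℝ) ^ 3 * Real.cos (2 * Real.pi * (∑ i, ((fun i => ((c i : ℕ) : ℤ)) i : ℝ) * ((j i : ℕ) : ℝ)) / n))) hper hFi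
  -- per-class bound, for a.e. `t`
  have hclass : ∀ c : Fin 3 → Fin n, ∀ᵐ t ∂(volume.restrict (Ioo 0 T)),
      ∫ x, ‖∑ j : Fin 3 → Fin n, (1 / (n:ℝ) ^ 3 * Real.cos (2 * Real.pi * (∑ i, ((fun i => ((c i : ℕ) : ℤ)) i : ℝ) * ((j i : ℕ) : ℝ)) / n)) • u t (x + (fun i => ((((j i : ℕ) : ℝ) / n : ℝ) : UnitAddCircle)))‖ ^ 2 ≤
        CK * Real.exp (-(2 * cK * ν * t)) * ∫ x, ‖∑ j : Fin 3 → Fin n, (1 / (n:ℝ) ^ 3 * Real.cos (2 * Real.pi * (∑ i, ((fun i => ((c i : ℕ) : ℤ)) i : ℝ) * ((j i : ℕ) : ℝ)) / n)) • F (x + (fun i => ((((j i : ℕ) : ℝ) / n : ℝ) : UnitAddCircle)))‖ ^ 2 := by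
    intro c
    by_cases hfar : ∀ z : Fin 3 → ℤ, L ≤ ‖Torus.latticeVec ((fun i => ((c i : ℕ) : ℤ)) + (n:ℤ) • z)‖
    · -- far class: the per-class clause
      exact hC ν hν n hn 𝔸 hodd hwin L hL hKL ((fun i => ((c i : ℕ) : ℤ))) hfar trivial _ (isDatum_pairProj hn0 ((fun i => ((c i : ℕ) : ℤ))) hF)
        (fun k' h1 h2 => modeCoeff_pairProj_eq_zero_off hn0 ((fun i => ((c i : ℕ) : ℤ))) hFi k' h1 h2) T hT _ (hRu c)
    · -- near class: no datum, hence no solution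
      push Not at hfar
      obtain ⟨z, hz⟩ := hfar
      have h0 : (fun x => ∑ j : Fin 3 → Fin n, (1 / (n:ℝ) ^ 3 * Real.cos (2 * Real.pi * (∑ i, ((fun i => ((c i : ℕ) : ℤ)) i : ℝ) * ((j i : ℕ) : ℝ)) / n)) • F (x + (fun i => ((((j i : ℕ) : ℝ) / n : ℝ) : UnitAddCircle)))) =ᵐ[volume] 0 :=
        pairProj_ae_eq_zero_of_near hn0 ((fun i => ((c i : ℕ) : ℤ))) hFi hsupp ⟨z, hz⟩
      have hzero := ((hRu c).of_ae_eq_datum h0).ae_eq_zero_of_memLp_top hN hlo' hb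
      filter_upwards [hzero] with t ht
      have e1 : ∫ x, ‖∑ j : Fin 3 → Fin n, (1 / (n:ℝ) ^ 3 * Real.cos (2 * Real.pi * (∑ i, ((fun i => ((c i : ℕ) : ℤ)) i : ℝ) * ((j i : ℕ) : ℝ)) / n)) • u t (x + (fun i => ((((j i : ℕ) : ℝ) / n : ℝ) : UnitAddCircle)))‖ ^ 2 = 0 := by
        have hae : (fun x => ‖∑ j : Fin 3 → Fin n, (1 / (n:ℝ) ^ 3 * Real.cos (2 * Real.pi * (∑ i, ((fun i => ((c i : ℕ) : ℤ)) i : ℝ) * ((j i : ℕ) : ℝ)) / n)) • u t (x + (fun i => ((((j i : ℕ) : ℝ) / n : ℝ) : UnitAddCircle)))‖ ^ 2) =ᵐ[volume] fun _ => (0:ℝ) := by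
          filter_upwards [ht] with x hx
          have hx' : ∑ j : Fin 3 → Fin n, (1 / (n:ℝ) ^ 3 * Real.cos (2 * Real.pi * (∑ i, ((fun i => ((c i : ℕ) : ℤ)) i : ℝ) * ((j i : ℕ) : ℝ)) / n)) • u t (x + (fun i => ((((j i : ℕ) : ℝ) / n : ℝ) : UnitAddCircle))) = 0 := hx
          rw [hx', norm_zero, zero_pow two_ne_zero]
        rw [integral_congr_ae hae, integral_zero]
      have e2 : ∫ x, ‖∑ j : Fin 3 → Fin n, (1 / (n:ℝ) ^ 3 * Real.cos (2 * Real.pi * (∑ i, ((fun i => ((c i : ℕ) : ℤ)) i : ℝ) * ((j i : ℕ) : ℝ)) / n)) • F (x + (fun i => ((((j i : ℕ) : ℝ) / n : ℝ) : UnitAddCircle)))‖ ^ 2 = 0 := by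
        have hae : (fun x => ‖∑ j : Fin 3 → Fin n, (1 / (n:ℝ) ^ 3 * Real.cos (2 * Real.pi * (∑ i, ((fun i => ((c i : ℕ) : ℤ)) i : ℝ) * ((j i : ℕ) : ℝ)) / n)) • F (x + (fun i => ((((j i : ℕ) : ℝ) / n : ℝ) : UnitAddCircle)))‖ ^ 2) =ᵐ[volume] fun _ => (0:ℝ) := by
          filter_upwards [h0] with x hx
          have hx' : ∑ j : Fin 3 → Fin n, (1 / (n:ℝ) ^ 3 * Real.cos (2 * Real.pi * (∑ i, ((fun i => ((c i : ℕ) : ℤ)) i : ℝ) * ((j i : ℕ) : ℝ)) / n)) • F (x + (fun i => ((((j i : ℕ) : ℝ) / n : ℝ) : UnitAddCircle))) = 0 := hx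
          rw [hx', norm_zero, zero_pow two_ne_zero]
        rw [integral_congr_ae hae, integral_zero]
      rw [e1, e2, mul_zero]
  -- assembly over the classes by Parseval
  have hall := (ae_all_iff).2 hclass
  filter_upwards [hall, hu.ae_memLp_two, ae_restrict_mem measurableSet_Ioo] with t ht hut htI
  rw [integral_norm_sq_eq_sum_classes hn0 hut, integral_norm_sq_eq_sum_classes hn0 hF2, Finset.mul_sum]
  refine Finset.sum_le_sum fun c _ => ?_
  have hβ : 0 ≤ (if ∀ i, (n:ℤ) ∣ 2 * ((c i : ℕ) : ℤ) then (1:ℝ) else 2) := by split_ifs <;> norm_num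
  calc (if ∀ i, (n:ℤ) ∣ 2 * ((c i : ℕ) : ℤ) then (1:ℝ) else 2) * ∫ x, ‖∑ j : Fin 3 → Fin n, (1 / (n:ℝ) ^ 3 * Real.cos (2 * Real.pi * (∑ i, ((fun i => ((c i : ℕ) : ℤ)) i : ℝ) * ((j i : ℕ) : ℝ)) / n)) • u t (x + (fun i => ((((j i : ℕ) : ℝ) / n : ℝ) : UnitAddCircle)))‖ ^ 2
      ≤ (if ∀ i, (n:ℤ) ∣ 2 * ((c i : ℕ) : ℤ) then (1:ℝ) else 2) * (CK * Real.exp (-(2 * cK * ν * t)) * ∫ x, ‖∑ j : Fin 3 → Fin n, (1 / (n:ℝ) ^ 3 * Real.cos (2 * Real.pi * (∑ i, ((fun i => ((c i : ℕ) : ℤ)) i : ℝ) * ((j i : ℕ) : ℝ)) / n)) • F (x + (fun i => ((((j i : ℕ) : ℝ) / n : ℝ) : UnitAddCircle)))‖ ^ 2) :=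
        mul_le_mul_of_nonneg_left (ht c) hβ
    _ = CK * Real.exp (-(2 * cK * ν * t)) *
        ((if ∀ i, (n:ℤ) ∣ 2 * ((c i : ℕ) : ℤ) then (1:ℝ) else 2) * ∫ x, ‖∑ j : Fin 3 → Fin n, (1 / (n:ℝ) ^ 3 * Real.cos (2 * Real.pi * (∑ i, ((fun i => ((c i : ℕ) : ℤ)) i : ℝ) * ((j i : ℕ) : ℝ)) / n)) • F (x + (fun i => ((((j i : ℕ) : ℝ) / n : ℝ) : UnitAddCircle)))‖ ^ 2) := by ring

end Summit.AnomalousDissipation.AnomalousDissipation.Theorems.SolenoidalFractalHomogenisation.LagrangianStep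

end
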